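import Summits.BirchSwinnertonDyer.BirchSwinnertonDyer.Theses.TangentCone
import Summits.BirchSwinnertonDyer.BirchSwinnertonDyer.Theorems.SqueezeUB.Negative.FalseWithoutIsElliptic
import Literature.NumberTheory.EllipticCurves.BSDSha

/-!
# BirchSwinnertonDyer — crux `RankLeOne` (stmt-BirchSwinnertonDyer-17610, route TangentCone):
# negative lemmas (standing disprover, cycle 1)

Load-bearing analysis of
`RankLeOne := ∀ (W : WeierstrassCurve ℚ) [W.IsElliptic] (h : W.analyticRank ≤ 1),
  W.mordellWeilRank = W.analyticRank ∧ Finite W.sha`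
(verbatim the Literature fact bsd.S17 `rank_eq_analyticRank_of_analyticRank_le_one`,
Gross–Zagier 1986 + Kolyvagin 1990 + modularity; Darmon 2004 Thm 3.22) as kernel-checked theorems.
No route statement is asserted positively and no definition is introduced (statements are inlined,
the witness is the literal `⟨0, 0, 0, 0, 0⟩`).

* `rankLeOne_false_without_isElliptic` — the instance binder `[W.IsElliptic]` is LOAD-BEARING: the
  binder-free statement is FALSE. Witness: the cuspidal cubic `y² = x³`, whose Mathlib L-function is
  `1` (every place additive), so `analyticRank = 0 ≤ 1`, while `E_ns(ℚ) ≅ (ℚ, +)` gives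
  `mordellWeilRank = finrank ℤ ℚ = 1 ≠ 0`. The cusp computations are the landed theorems
  `squeezeUB_cusp_analyticRank`, `squeezeUB_cusp_mordellWeilRank` of
  `Theorems/SqueezeUB/Negative/FalseWithoutIsElliptic.lean` (REUSED, not re-proved).
* `rankLeOne_withoutBound_iff_summit_and_shaFinite` — the bound `(h : W.analyticRank ≤ 1)` is
  load-bearing modulo open conjectures: dropping it yields EXACTLY the summit statement
  `BirchSwinnertonDyer` (= `Literature.BSDRankConjecture`) together with the Tate–Shafarevich
  conjecture over `ℚ` (`Literature.NumberTheory.EllipticCurves.ShaFiniteConjecture`); hence no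
  `¬`-lemma for that binder can exist short of refuting BSD ∧ Ш-finiteness.
Full adversarial record (why the crux itself resists: it is Gross–Zagier–Kolyvagin, typed faithfully;
definitional-junk audit; stub side conditions): `Cruxes/RankLeOne/Disproof.lean`.
-/

set_option linter.dupNamespace false

namespace Summit.BirchSwinnertonDyer.BirchSwinnertonDyer.Theorems

open Literature.NumberTheory.EllipticCurves

/-- **`[W.IsElliptic]` is load-bearing in `TangentCone.RankLeOne`**: over ALL Weierstrass cubics
the statement is false. Witness `y² = x³` (`⟨0,0,0,0,0⟩`): `analyticRank = 0` (L ≡ 1) but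
`mordellWeilRank = finrank ℤ E_ns(ℚ) = finrank ℤ ℚ = 1` (Silverman AEC III.2.5 for
`E_ns ≅ 𝔾_a`; cusp lemmas of `SqueezeUB/Negative/FalseWithoutIsElliptic`). [folklore] -/
theorem rankLeOne_false_without_isElliptic :
    ¬ ∀ (W : WeierstrassCurve ℚ), W.analyticRank ≤ 1 →
        W.mordellWeilRank = W.analyticRank ∧ Finite W.sha := by
  intro h
  have h1 := (h ⟨0, 0, 0, 0, 0⟩ (by rw [squeezeUB_cusp_analyticRank]; exact Nat.zero_le 1)).1
  rw [squeezeUB_cusp_analyticRank, squeezeUB_cusp_mordellWeilRank] at h1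
  exact one_ne_zero h1

/-- **The bound `analyticRank ≤ 1` is what separates the crux from the summit**: with the bound
dropped, `TangentCone.RankLeOne` becomes exactly `BirchSwinnertonDyer ∧ ShaFiniteConjecture`
(BSD rank conjecture, Wiles Clay 2000; finiteness of Ш, Silverman AEC Conj. X.4.13). [folklore] -/
theorem rankLeOne_withoutBound_iff_summit_and_shaFinite :
    (∀ (W : WeierstrassCurve ℚ) [W.IsElliptic], W.mordellWeilRank = W.analyticRank ∧ Finite W.sha) ↔
      (_root_.BirchSwinnertonDyer ∧ ShaFiniteConjecture) := by
  constructor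
  · intro h
    exact ⟨fun W hW => ((@h W hW).1).symm, fun W hW => (@h W hW).2⟩
  · rintro ⟨hB, hS⟩ W hW
    exact ⟨(hB W hW).symm, hS W hW⟩

end Summit.BirchSwinnertonDyer.BirchSwinnertonDyer.Theorems
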